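import Summits.HubbardSuperconductivity.HubbardSuperconductivity.Theses.NoGo
import Literature.MathematicalPhysics.QuantumLattice.HubbardRingPerronFrobeniusProofs
import Literature.MathematicalPhysics.QuantumLattice.PairCorrelationsProofs

/-!
# HubbardSuperconductivity / NoGo — the thesis `NogoThesis` reduced to its LRO clause

Route `NoGo`, item `stmt-HubbardSuperconductivity-0167` (target `NogoThesis`, the quantifier-pushed
negation of the pre-audit summit statement): for every `U ≠ 0` and `δ ∈ (0,1)` SOME sequence of
normalised `(N_L, S^z = 0)`-sector ground states of `hubbardTorus 2 L 1 U`,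
`N_L = 2⌊(1-δ)L²/2⌋`, has no `d_{x²-y²}` pair-field long-range order.

This file proves the parts of `NogoThesis` that are provable today and isolates the rest:

* `exists_unit_groundStateInSector_hubbardTorus`, `exists_groundStateInSector_seq`: the
  HYPOTHESIS half of the thesis holds for every real `t`, `U`, `δ ≥ -1` — normalised sector
  ground-state sequences exist at every side `L` (finite-dimensional spectral theory in the
  coordinate sector `szSector (2n) 0`, `szSector_groundState`; `n = ⌊(1-δ)L²/2⌋ ≤ L² = |Λ_L|`).
* `not_hasPairFieldLRO_iff_of_hyp`: under that hypothesis the conclusion `¬ HasPairFieldLRO` is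
  literally `liminf_L L⁻⁴ re ⟨ψ_L, Δ_d† Δ_d ψ_L⟩ ≤ 0` (`hasPairFieldLRO_iff_liminf_holds`).
* `nogoThesis_iff_liminf`: hence `NogoThesis` is EQUIVALENT to the bare analytic statement
  "for every `U ≠ 0`, `δ ∈ (0,1)` some sector ground-state sequence has
  `liminf_L L⁻⁴ ‖Δ_d ψ_L‖² ≤ 0`" — the absence of `d`-wave superconducting order in the
  two-dimensional Hubbard ground state at every coupling and doping, an open problem (expected to
  be false at weak repulsive coupling, Raghu–Kivelson–Scalapino 2010).
* `pairFieldSeq_nonneg`, `pairFieldSeq_le`, `liminf_pairFieldSeq_le_zero_iff`,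
  `nogoThesis_iff_frequently`: the LRO sequence lives in `[0, C_g²]`, so the `liminf` is honest
  and `NogoThesis` needs LRO-freeness only along SOME subsequence of sides (e.g. the odd ones).
* `nogoAttractiveExclusion_of_nogoThesis`, `nogoNagaokaWindow_of_nogoThesis`,
  `nogoStripeWindow_of_nogoThesis`: the regional cruxes of the route are corollaries of the
  thesis (not conversely).
* `not_hubbardSuperconductivity_iff`, `not_hubbardSuperconductivity_of_allSides`: the correct
  quantifier-pushed negation of the AUDITED summit statement (`U > 0`, `δ ∈ (0, 1/2)`, even
  sides), which differs from `NogoThesis` in range and in the sides it constrains.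

Sources: E. H. Lieb, PRL 62 (1989) 1201 (sector ground states); D. J. Scalapino, Phys. Rep. 250
(1995) 329, §2 eq. (2.4) (pair-field LRO); H. Tasaki, *Physics and Mathematics of Quantum
Many-Body Systems* (2020) §2.2.
-/

noncomputable section

namespace Summit.HubbardSuperconductivity.NoGo

open Matrix Filter Literature.MathematicalPhysics.QuantumLattice Literature.Probability.LatticeModels
open scoped ComplexOrder

/-- `IsGroundStateInSector` is invariant under nonzero rescaling (membership in the sector
submodule, non-vanishing and the eigenvalue equation are all homogeneous). Tasaki (2020) §2.2. [folklore] -/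
theorem isGroundStateInSector_smul {Λ : Type*} [LinearOrder Λ] [Fintype Λ]
    (H : Matrix (Finset (Orb Λ)) (Finset (Orb Λ)) ℂ) (N : ℕ) (M : ℝ) {ψ : Fock (Orb Λ)}
    (h : IsGroundStateInSector H N M ψ) {c : ℂ} (hc : c ≠ 0) :
    IsGroundStateInSector H N M (c • ψ) := by
  obtain ⟨hmem, hne, heig⟩ := h
  refine ⟨Submodule.smul_mem _ c hmem, smul_ne_zero hc hne, ?_⟩
  rw [mulVec_smul, heig, smul_comm]

/-- The fermionic torus `(ℤ/Lℤ)²` has `L²` sites. Friedli–Velenik (2017) §3.1. [folklore] -/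
theorem card_fermionTorus_two (L : ℕ) : Fintype.card (FermionTorus 2 L) = L ^ 2 := by
  simp [FermionTorus, Fintype.card_lex]

/-- **Normalised sector ground states exist on the torus.** For every side `L`, hopping `t`,
coupling `U` and `n ≤ L²` there is a unit vector which is a ground state of `hubbardTorus 2 L t U`
in the joint sector `(N, S^z) = (2n, 0)`. (Finite-dimensional spectral theory in the coordinate
sector, `szSector_groundState`, then normalisation.) Lieb, PRL 62 (1989) 1201, proof of Thm 1;
Tasaki (2020) §2.2. [folklore] -/
theorem exists_unit_groundStateInSector_hubbardTorus (L : ℕ) (t U : ℝ) {n : ℕ} (hn : n ≤ L ^ 2) :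
    ∃ ψ : Fock (Orb (FermionTorus 2 L)),
      star ψ ⬝ᵥ ψ = 1 ∧ IsGroundStateInSector (hubbardTorus 2 L t U) (2 * n) 0 ψ := by
  have hcard : n ≤ Fintype.card (FermionTorus 2 L) := by rwa [card_fermionTorus_two]
  obtain ⟨⟨ψ, hψ⟩, -⟩ := szSector_groundState (fermionTorusGraph 2 L) t U hcard
  obtain ⟨c, hc, hc1⟩ := exists_smul_unit hψ.2.1
  exact ⟨c • ψ, hc1, isGroundStateInSector_smul _ _ _ hψ hc⟩

/-- The prescribed pair number `⌊(1-δ)L²/2⌋` fits into the torus: `⌊(1-δ)L²/2⌋ ≤ L²` as soon as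
`δ ≥ -1`. [folklore] -/
theorem floor_pairNumber_le (δ : ℝ) (hδ : -1 ≤ δ) (L : ℕ) :
    ⌊(1 - δ) * (L : ℝ) ^ 2 / 2⌋₊ ≤ L ^ 2 := by
  refine Nat.floor_le_of_le ?_
  have hL : (0 : ℝ) ≤ (L : ℝ) ^ 2 := by positivity
  push_cast
  nlinarith

/-- **The hypothesis half of `NogoThesis` (and of every regional item of route `NoGo`) holds
unconditionally**: for all real `t`, `U` and `δ ≥ -1` there is a sequence of normalised ground
states `ψ_L` of `hubbardTorus 2 L t U` in the sectors `(N_L, S^z = 0)`, `N_L = 2⌊(1-δ)L²/2⌋`, one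
for EVERY side `L` (including `L = 0, 1`, where the sector is the vacuum line).
Lieb, PRL 62 (1989) 1201; Tasaki (2020) §2.2. [folklore] -/
theorem exists_groundStateInSector_seq (t U δ : ℝ) (hδ : -1 ≤ δ) :
    ∃ (N : ℕ → ℕ) (ψ : ∀ L, Fock (Orb (FermionTorus 2 L))),
      ∀ L, N L = 2 * ⌊(1 - δ) * (L : ℝ) ^ 2 / 2⌋₊ ∧ star (ψ L) ⬝ᵥ ψ L = 1 ∧
        IsGroundStateInSector (hubbardTorus 2 L t U) (N L) 0 (ψ L) := by
  choose ψ hψ using fun L =>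
    exists_unit_groundStateInSector_hubbardTorus L t U (floor_pairNumber_le δ hδ L)
  exact ⟨fun L => 2 * ⌊(1 - δ) * (L : ℝ) ^ 2 / 2⌋₊, ψ, fun L => ⟨rfl, (hψ L).1, (hψ L).2⟩⟩

/-- Under the hypothesis clause (sector ground states, normalised), the particle-number and
normalisation conjunct of `HasPairFieldLRO` is automatic, so `¬ HasPairFieldLRO g N ψ` is exactly
the analytic statement `liminf_L L⁻⁴ re ⟨ψ_L, Δ_g† Δ_g ψ_L⟩ ≤ 0` (index shifted to `L + 1` as in
`hasPairFieldLRO_iff_liminf`). Scalapino, Phys. Rep. 250 (1995) 329, §2 eq. (2.4). [folklore] -/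
theorem not_hasPairFieldLRO_iff_of_hyp (g : Site 2 → ℝ) {t U : ℝ} {N : ℕ → ℕ}
    {ψ : ∀ L, Fock (Orb (FermionTorus 2 L))}
    (hyp : ∀ L, star (ψ L) ⬝ᵥ ψ L = 1 ∧ IsGroundStateInSector (hubbardTorus 2 L t U) (N L) 0 (ψ L)) :
    ¬ HasPairFieldLRO g N ψ ↔
      liminf (fun L : ℕ =>
        (expect ((pairField g (L + 1))ᴴ * pairField g (L + 1)) (ψ (L + 1))).re /
          ((L + 1 : ℕ) : ℝ) ^ 4) atTop ≤ 0 := by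
  have hnorm : ∀ L, IsNParticle (N L) (ψ L) ∧ star (ψ L) ⬝ᵥ ψ L = 1 := fun L =>
    ⟨((mem_szSector_iff _ _ _).1 (hyp L).2.1).1, (hyp L).1⟩
  rw [hasPairFieldLRO_iff_liminf_holds g N ψ, not_and, not_lt]
  exact ⟨fun h => h hnorm, fun h _ => h⟩

/-- **`NogoThesis` reduced to its analytic content.** The route thesis is equivalent to: for every
`U ≠ 0` and `δ ∈ (0, 1)` some sequence of normalised `(2⌊(1-δ)L²/2⌋, S^z = 0)`-sector ground states
of the pure Hubbard model on the tori `(ℤ/Lℤ)²` (ALL sides `L`) satisfies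
`liminf_L L⁻⁴ re ⟨ψ_L, Δ_d† Δ_d ψ_L⟩ ≤ 0`, i.e. has no `d_{x²-y²}` pair-field long-range order —
the existence of the ground-state sequences themselves being settled by
`exists_groundStateInSector_seq`. This residual statement is the (negation of the) open problem of
`d`-wave superconductivity in the two-dimensional Hubbard ground state, asserted at EVERY coupling
and doping. Scalapino, Phys. Rep. 250 (1995) 329, §2; Lieb, PRL 62 (1989) 1201. [folklore] -/
theorem nogoThesis_iff_liminf :
    Summit.HubbardSuperconductivity.HubbardSuperconductivity.Theses.NoGo.NogoThesis ↔
      ∀ U : ℝ, U ≠ 0 → ∀ δ ∈ Set.Ioo (0:ℝ) 1, ∃ (N : ℕ → ℕ)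
        (ψ : ∀ L, Fock (Orb (FermionTorus 2 L))),
        (∀ L, N L = 2 * ⌊(1 - δ) * (L : ℝ) ^ 2 / 2⌋₊ ∧ star (ψ L) ⬝ᵥ ψ L = 1 ∧
            IsGroundStateInSector (hubbardTorus 2 L 1 U) (N L) 0 (ψ L)) ∧
          liminf (fun L : ℕ =>
            (expect ((pairField dWaveFormFactor (L + 1))ᴴ * pairField dWaveFormFactor (L + 1))
                (ψ (L + 1))).re / ((L + 1 : ℕ) : ℝ) ^ 4) atTop ≤ 0 := by
  unfold Summit.HubbardSuperconductivity.HubbardSuperconductivity.Theses.NoGo.NogoThesis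
  refine forall₂_congr fun U _ => forall₂_congr fun δ _ => ?_
  refine exists_congr fun N => exists_congr fun ψ => ?_
  constructor
  · rintro ⟨hyp, hno⟩
    exact ⟨hyp, (not_hasPairFieldLRO_iff_of_hyp dWaveFormFactor fun L => (hyp L).2).1 hno⟩
  · rintro ⟨hyp, hlim⟩
    exact ⟨hyp, (not_hasPairFieldLRO_iff_of_hyp dWaveFormFactor fun L => (hyp L).2).2 hlim⟩


/-! ### A-priori bounds on the LRO sequence; the thesis needs only a subsequence -/

/-- The normalised LRO sequence `L ↦ (L+1)⁻⁴ re ⟨ψ_{L+1}, Δ_g† Δ_g ψ_{L+1}⟩` is nonnegative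
(`Δ_g† Δ_g` is a Gram operator). Scalapino, Phys. Rep. 250 (1995) 329, §2. [folklore] -/
theorem pairFieldSeq_nonneg (g : Site 2 → ℝ) (ψ : ∀ L, Fock (Orb (FermionTorus 2 L))) (L : ℕ) :
    0 ≤ (expect ((pairField g (L + 1))ᴴ * pairField g (L + 1)) (ψ (L + 1))).re /
      ((L + 1 : ℕ) : ℝ) ^ 4 := by
  refine div_nonneg ?_ (by positivity)
  rw [PosSemidefTrace.expect_conjTranspose_mul, ← norm_toLp_sq_eq_re]
  positivity

/-- The normalised LRO sequence of a family of unit vectors is bounded above by the constant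
`C_g² = (Σ_{e ∈ {0} ∪ unitSteps} 2|g e|/√2)²` (sum rule `re ⟨Δ_g† Δ_g⟩ = Σ_{x,y} G(x,y)` and the
pointwise bound `G(x,y) ≤ C_g²`, `pairFieldCorr_succ_le`); in particular the real `liminf` in
`HasPairFieldLRO` is a genuine number in `[0, C_g²]`, never a junk value.
Scalapino, Phys. Rep. 250 (1995) 329, §2. [folklore] -/
theorem pairFieldSeq_le (g : Site 2 → ℝ) (ψ : ∀ L, Fock (Orb (FermionTorus 2 L)))
    (hnorm : ∀ L, star (ψ L) ⬝ᵥ ψ L = 1) (L : ℕ) :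
    (expect ((pairField g (L + 1))ᴴ * pairField g (L + 1)) (ψ (L + 1))).re /
        ((L + 1 : ℕ) : ℝ) ^ 4 ≤
      (∑ e ∈ insert 0 unitSteps, ‖((g e / Real.sqrt 2 : ℝ) : ℂ)‖ * 2) ^ 2 := by
  have hpos : (0 : ℝ) < ((L + 1 : ℕ) : ℝ) ^ 4 := by positivity
  rw [div_le_iff₀ hpos, ← sum_pairFieldCorr_succ]
  calc ∑ x : TorusSite 2 (L + 1), ∑ y, pairFieldCorr g ψ (L + 1) x y
      ≤ ∑ x : TorusSite 2 (L + 1), ∑ y : TorusSite 2 (L + 1),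
          (∑ e ∈ insert 0 unitSteps, ‖((g e / Real.sqrt 2 : ℝ) : ℂ)‖ * 2) ^ 2 :=
        Finset.sum_le_sum fun x _ => Finset.sum_le_sum fun y _ =>
          pairFieldCorr_succ_le g ψ L (hnorm (L + 1)) x y
    _ = (∑ e ∈ insert 0 unitSteps, ‖((g e / Real.sqrt 2 : ℝ) : ℂ)‖ * 2) ^ 2 *
          ((L + 1 : ℕ) : ℝ) ^ 4 := by
        simp only [Finset.sum_const, Finset.card_univ, Fintype.card_pi, ZMod.card,
          Finset.prod_const, Fintype.card_fin]
        push_cast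
        ring

/-- For a family of unit vectors, `liminf_L (L+1)⁻⁴ re ⟨Δ_g† Δ_g⟩ ≤ 0` says exactly that the
sequence dips below every `ε > 0` infinitely often, i.e. that it tends to `0` along SOME
subsequence of sides (the sequence lives in `[0, C_g²]`, `pairFieldSeq_nonneg`, `pairFieldSeq_le`,
so Mathlib's `Filter.liminf_le_iff` applies with honest (co)boundedness).
Friedli–Velenik (2017) §3.7.2 (LRO as a `liminf`). [folklore] -/
theorem liminf_pairFieldSeq_le_zero_iff (g : Site 2 → ℝ) (ψ : ∀ L, Fock (Orb (FermionTorus 2 L)))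
    (hnorm : ∀ L, star (ψ L) ⬝ᵥ ψ L = 1) :
    liminf (fun L : ℕ =>
        (expect ((pairField g (L + 1))ᴴ * pairField g (L + 1)) (ψ (L + 1))).re /
          ((L + 1 : ℕ) : ℝ) ^ 4) atTop ≤ 0 ↔
      ∀ ε : ℝ, 0 < ε → ∃ᶠ L : ℕ in atTop,
        (expect ((pairField g (L + 1))ᴴ * pairField g (L + 1)) (ψ (L + 1))).re /
          ((L + 1 : ℕ) : ℝ) ^ 4 < ε := by
  rw [liminf_le_iff
    (isCoboundedUnder_ge_of_eventually_le _ (Eventually.of_forall (pairFieldSeq_le g ψ hnorm)))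
    (isBoundedUnder_of ⟨0, fun L => pairFieldSeq_nonneg g ψ L⟩)]

/-- **`NogoThesis` needs only a subsequence of sides.** The thesis is equivalent to: for every
`U ≠ 0` and `δ ∈ (0,1)` some all-sides sequence of normalised sector ground states has, for every
`ε > 0`, infinitely many sides `L + 1` with `(L+1)⁻⁴ re ⟨ψ_{L+1}, Δ_d† Δ_d ψ_{L+1}⟩ < ε`. In
particular `NogoThesis` is already implied by LRO-freeness along ANY infinite set of sides (e.g.
the odd ones), whereas the audited summit statement `HubbardSuperconductivity` constrains even
sides only — the formal gap between `NogoThesis` and `¬ HubbardSuperconductivity` recorded on the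
ledger (grounder note on stmt-0167, 2026-08-14). Scalapino, Phys. Rep. 250 (1995) 329, §2;
Friedli–Velenik (2017) §3.7.2. [folklore] -/
theorem nogoThesis_iff_frequently :
    Summit.HubbardSuperconductivity.HubbardSuperconductivity.Theses.NoGo.NogoThesis ↔
      ∀ U : ℝ, U ≠ 0 → ∀ δ ∈ Set.Ioo (0:ℝ) 1, ∃ (N : ℕ → ℕ)
        (ψ : ∀ L, Fock (Orb (FermionTorus 2 L))),
        (∀ L, N L = 2 * ⌊(1 - δ) * (L : ℝ) ^ 2 / 2⌋₊ ∧ star (ψ L) ⬝ᵥ ψ L = 1 ∧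
            IsGroundStateInSector (hubbardTorus 2 L 1 U) (N L) 0 (ψ L)) ∧
          ∀ ε : ℝ, 0 < ε → ∃ᶠ L : ℕ in atTop,
            (expect ((pairField dWaveFormFactor (L + 1))ᴴ * pairField dWaveFormFactor (L + 1))
                (ψ (L + 1))).re / ((L + 1 : ℕ) : ℝ) ^ 4 < ε := by
  rw [nogoThesis_iff_liminf]
  refine forall₂_congr fun U _ => forall₂_congr fun δ _ => ?_
  refine exists_congr fun N => exists_congr fun ψ => and_congr_right fun hyp => ?_
  exact liminf_pairFieldSeq_le_zero_iff dWaveFormFactor ψ fun L => (hyp L).2.1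

/-! ### Position of the thesis in the route and with respect to the audited summit statement -/

/-- `NogoThesis` implies the attractive regional item `NogoAttractiveExclusion` (restriction to
`U < 0`): the thesis is the STRONGEST statement of route `NoGo`, the regional cruxes are its
corollaries, not conversely (their regions do not cover weak repulsive coupling). [folklore] -/
theorem nogoAttractiveExclusion_of_nogoThesis
    (h : Summit.HubbardSuperconductivity.HubbardSuperconductivity.Theses.NoGo.NogoThesis) :
    Summit.HubbardSuperconductivity.HubbardSuperconductivity.Theses.NoGo.NogoAttractiveExclusion :=
  fun U hU δ hδ => h U hU.ne δ hδ

/-- `NogoThesis` implies the Nagaoka-window item `NogoNagaokaWindow` (with the window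
`U > 0`, `δ < 1/2`). [folklore] -/
theorem nogoNagaokaWindow_of_nogoThesis
    (h : Summit.HubbardSuperconductivity.HubbardSuperconductivity.Theses.NoGo.NogoThesis) :
    Summit.HubbardSuperconductivity.HubbardSuperconductivity.Theses.NoGo.NogoNagaokaWindow := by
  refine ⟨0, 1 / 2, ⟨by norm_num, by norm_num⟩, fun U hU δ hδ => h U hU.ne' δ ⟨hδ.1, ?_⟩⟩
  linarith [hδ.2]

/-- `NogoThesis` implies the stripe-window item `NogoStripeWindow` (`U ∈ [6,8]`,
`δ ∈ [1/10, 1/6]`). [folklore] -/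
theorem nogoStripeWindow_of_nogoThesis
    (h : Summit.HubbardSuperconductivity.HubbardSuperconductivity.Theses.NoGo.NogoThesis) :
    Summit.HubbardSuperconductivity.HubbardSuperconductivity.Theses.NoGo.NogoStripeWindow := by
  intro U hU δ hδ
  exact h U (by linarith [hU.1]) δ ⟨by linarith [hδ.1], by linarith [hδ.2]⟩

/-- **The correct negation of the audited summit statement.** Since the 2026-08-13 audit,
`HubbardSuperconductivity` quantifies `U > 0`, `δ ∈ (0, 1/2)`, hypotheses at EVEN sides only and
concludes long-range order along even sides; its negation, pushed through the quantifiers, is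
therefore the statement displayed here (pure logic) — and NOT `NogoThesis`, which asks hypotheses
at all sides, concludes `¬`(all-sides LRO), and ranges over `U ≠ 0`, `δ ∈ (0,1)`. Neither
implication between `NogoThesis` and `¬ HubbardSuperconductivity` is formal: an all-sides
LRO-free witness may fail only along odd sides (`nogoThesis_iff_frequently`), and `¬S` says
nothing at `U < 0` or `δ ≥ 1/2`. [folklore] -/
theorem not_hubbardSuperconductivity_iff :
    ¬ HubbardSuperconductivity ↔
      ∀ U : ℝ, 0 < U → ∀ δ ∈ Set.Ioo (0:ℝ) (1 / 2), ∃ (N : ℕ → ℕ)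
        (ψ : ∀ L, Fock (Orb (FermionTorus 2 L))),
        (∀ L, Even L → N L = 2 * ⌊(1 - δ) * (L : ℝ) ^ 2 / 2⌋₊ ∧ star (ψ L) ⬝ᵥ ψ L = 1 ∧
            IsGroundStateInSector (hubbardTorus 2 L 1 U) (N L) 0 (ψ L)) ∧
          ¬ HasLongRangeOrder (fun k => halfOpenBox 2 (2 * k))
              (fun k => torusPullback (pairFieldCorr dWaveFormFactor ψ) (2 * k)) := by
  constructor
  · intro h U hU δ hδ
    by_contra hc
    refine h ⟨U, hU, δ, hδ, fun N ψ hyp => ?_⟩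
    by_contra hno
    exact hc ⟨N, ψ, hyp, hno⟩
  · rintro h ⟨U, hU, δ, hδ, hall⟩
    obtain ⟨N, ψ, hyp, hno⟩ := h U hU δ hδ
    exact hno (hall N ψ hyp)

/-- Sufficient form with all-sides hypotheses (as produced by `exists_groundStateInSector_seq`):
if for every `U > 0` and `δ ∈ (0, 1/2)` some all-sides sequence of normalised sector ground
states has no `d`-wave pair-field LRO along EVEN sides, then `¬ HubbardSuperconductivity`.
This is the assembly shape a retyped thesis of route `NoGo` must have. [folklore] -/
theorem not_hubbardSuperconductivity_of_allSides
    (h : ∀ U : ℝ, 0 < U → ∀ δ ∈ Set.Ioo (0:ℝ) (1 / 2), ∃ (N : ℕ → ℕ)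
        (ψ : ∀ L, Fock (Orb (FermionTorus 2 L))),
        (∀ L, N L = 2 * ⌊(1 - δ) * (L : ℝ) ^ 2 / 2⌋₊ ∧ star (ψ L) ⬝ᵥ ψ L = 1 ∧
            IsGroundStateInSector (hubbardTorus 2 L 1 U) (N L) 0 (ψ L)) ∧
          ¬ HasLongRangeOrder (fun k => halfOpenBox 2 (2 * k))
              (fun k => torusPullback (pairFieldCorr dWaveFormFactor ψ) (2 * k))) :
    ¬ HubbardSuperconductivity := by
  rw [not_hubbardSuperconductivity_iff]
  intro U hU δ hδ
  obtain ⟨N, ψ, hyp, hno⟩ := h U hU δ hδ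
  exact ⟨N, ψ, fun L _ => hyp L, hno⟩

end Summit.HubbardSuperconductivity.NoGo
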